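import Mathlib

import Summits.MatrixMultiplication.MatrixMultiplication.Theses.NOFWindowCapacity

/-!
# `stub_seedQuotient` of line `integer-seed` (crux `Thesis`, stmt-MatrixMultiplication-7270) — sorry-free

An integer seed (legs `Fin N → ℤ^d`, `B` boxes partitioning `[N]³`, every box alien-free over `ℤ^d`, spectrum of size
`≤ K`, leg entries `≤ E`) descends to the cyclic host `ZMod M` for every prime `M` with `K < M` and `6E < M`, with the SAME
boxes: legs `φ ∘ s, φ ∘ t, φ ∘ u` for a functional `φ(v) = Σ_l λ_l · (v l : ZMod M)` that is non-zero on every non-zero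
spectrum vector.  Such `λ` exists by a greedy/inductive choice of coordinates (`exists_functional`: a set of `< M` non-zero
vectors of `(ZMod M)^d` admits a functional missing all of them — peel coordinate `0`, induct on `d`, and avoid the `< M`
forbidden values of `λ 0`), and non-zero spectrum vectors stay non-zero mod `M` because their entries are `≤ 6E < M`.
-/

set_option linter.unusedVariables false
set_option linter.unusedSectionVars false

namespace Summit.MatrixMultiplication.MatrixMultiplication.Theorems.Thesis.IntegerSeed

/-! ## Definitions of line `integer-seed` (verbatim from `Lines/integer_seed.lean`) -/

def AlienFree {G : Type} [AddCommGroup G] {N : ℕ} (s t u : Fin N → G) (P Q R : Finset (Fin N × Fin N)) : Prop :=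
  ∀ a ∈ P, ∀ b ∈ Q, ∀ c ∈ R, (t b.2 - s b.1) + (u c.2 - t c.1) = u a.2 - s a.1 → a.1 = b.1 ∧ b.2 = c.1 ∧ a.2 = c.2

def Partitions {N B : ℕ} (P Q R : Fin B → Finset (Fin N × Fin N)) : Prop :=
  ∀ i j k : Fin N, ∃! r : Fin B, (i, k) ∈ P r ∧ (i, j) ∈ Q r ∧ (j, k) ∈ R r

noncomputable def spectrum {G : Type} [AddCommGroup G] [DecidableEq G] {N B : ℕ} (s t u : Fin N → G)
    (P Q R : Fin B → Finset (Fin N × Fin N)) : Finset G :=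
  Finset.univ.biUnion fun r : Fin B => ((P r) ×ˢ (Q r) ×ˢ (R r)).image
    (fun abc => (t abc.2.1.2 - s abc.2.1.1) + (u abc.2.2.2 - t abc.2.2.1) - (u abc.1.2 - s abc.1.1))

def IntSeed (d N B K E : ℕ) : Prop :=
  ∃ (s t u : Fin N → (Fin d → ℤ)) (P Q R : Fin B → Finset (Fin N × Fin N)),
    (∀ r, AlienFree s t u (P r) (Q r) (R r)) ∧ Partitions P Q R ∧
    (spectrum s t u P Q R).card ≤ K ∧
    (∀ i l, |s i l| ≤ (E : ℤ) ∧ |t i l| ≤ (E : ℤ) ∧ |u i l| ≤ (E : ℤ))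

/-! ## A functional missing `< M` non-zero vectors -/

/-- Over the field `ZMod M` (`M` prime): fewer than `M` non-zero vectors of `(ZMod M)^d` are simultaneously missed by some
functional `a ↦ Σ_l λ_l a_l`.  Induction on `d`, peeling coordinate `0`. -/
theorem exists_functional {M : ℕ} [Fact M.Prime] :
    ∀ (d : ℕ) (A : Finset (Fin d → ZMod M)), A.card < M → (∀ a ∈ A, a ≠ 0) →
      ∃ lam : Fin d → ZMod M, ∀ a ∈ A, ∑ l, lam l * a l ≠ 0 := by
  classical
  intro d
  induction d with
  | zero =>
    intro A hA hne
    refine ⟨fun l => l.elim0, fun a ha => ?_⟩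
    exact absurd (Subsingleton.elim a 0) (hne a ha)
  | succ d ih =>
    intro A hA hne
    -- vectors with vanishing coordinate 0: their tails are non-zero; induct
    let A₁ : Finset (Fin d → ZMod M) := (A.filter fun a => a 0 = 0).image Fin.tail
    have hA₁card : A₁.card < M :=
      lt_of_le_of_lt (Finset.card_image_le.trans (Finset.card_filter_le _ _)) hA
    have hA₁ne : ∀ a' ∈ A₁, a' ≠ 0 := by
      intro a' ha' h0
      obtain ⟨a, ha, rfl⟩ := Finset.mem_image.mp ha'
      obtain ⟨haA, ha0⟩ := Finset.mem_filter.mp ha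
      apply hne a haA
      funext l
      refine Fin.cases ?_ (fun i => ?_) l
      · simpa using ha0
      · have := congrFun h0 i
        simpa [Fin.tail] using this
    obtain ⟨lam', hlam'⟩ := ih A₁ hA₁card hA₁ne
    -- forbidden values for coordinate 0
    let bad : Finset (ZMod M) :=
      (A.filter fun a => a 0 ≠ 0).image fun a => -(∑ l, lam' l * Fin.tail a l) * (a 0)⁻¹
    have hbad : bad.card < (Finset.univ : Finset (ZMod M)).card := by
      rw [Finset.card_univ, ZMod.card]
      exact lt_of_le_of_lt (Finset.card_image_le.trans (Finset.card_filter_le _ _)) hA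
    obtain ⟨c, -, hc⟩ := Finset.exists_mem_notMem_of_card_lt_card hbad
    refine ⟨Fin.cons c lam', fun a ha => ?_⟩
    rw [Fin.sum_univ_succ]
    simp only [Fin.cons_zero, Fin.cons_succ]
    by_cases h0 : a 0 = 0
    · -- coordinate 0 vanishes: the tail carries it
      have hmem : Fin.tail a ∈ A₁ := Finset.mem_image.mpr ⟨a, Finset.mem_filter.mpr ⟨ha, h0⟩, rfl⟩
      have := hlam' (Fin.tail a) hmem
      simpa [h0, Fin.tail] using this
    · intro hsum
      apply hc
      refine Finset.mem_image.mpr ⟨a, Finset.mem_filter.mpr ⟨ha, h0⟩, ?_⟩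
      -- c * a 0 + S = 0  ⇒  c = -S * (a 0)⁻¹
      have hS : c * a 0 = -(∑ l, lam' l * Fin.tail a l) := by
        have : (∑ i : Fin d, lam' i * a i.succ) = ∑ l, lam' l * Fin.tail a l := by simp [Fin.tail]
        rw [← this]; exact eq_neg_of_add_eq_zero_left hsum
      rw [← hS, mul_inv_cancel_right₀ h0]

/-! ## The stub -/

theorem stub_seedQuotient :
    ∀ d N B K E M : ℕ, IntSeed d N B K E → M.Prime → K < M → 6 * E < M →
      ∃ (s t u : Fin N → ZMod M) (P Q R : Fin B → Finset (Fin N × Fin N)),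
        (∀ r, AlienFree s t u (P r) (Q r) (R r)) ∧ Partitions P Q R := by
  classical
  intro d N B K E M hseed hM hKM hEM
  haveI : Fact M.Prime := ⟨hM⟩
  obtain ⟨s, t, u, P, Q, R, hAF, hPart, hcard, hE⟩ := hseed
  -- reduction mod M of integer vectors, and the non-zero spectrum vectors reduced
  let red : (Fin d → ℤ) → (Fin d → ZMod M) := fun v l => (v l : ZMod M)
  let A : Finset (Fin d → ZMod M) := ((spectrum s t u P Q R).filter fun v => v ≠ 0).image red
  have hAcard : A.card < M :=
    lt_of_le_of_lt ((Finset.card_image_le.trans (Finset.card_filter_le _ _)).trans hcard) hKM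
  -- entries of spectrum vectors are bounded by 6E < M, so non-zero vectors stay non-zero mod M
  have hentry : ∀ v ∈ spectrum s t u P Q R, ∀ l, |v l| ≤ 6 * (E : ℤ) := by
    intro v hv l
    simp only [spectrum, Finset.mem_biUnion, Finset.mem_univ, true_and, Finset.mem_image,
      Finset.mem_product] at hv
    obtain ⟨r, ⟨a, b, c⟩, -, rfl⟩ := hv
    simp only [Pi.add_apply, Pi.sub_apply]
    have h1 := (hE b.1 l).1; have h2 := (hE b.2 l).2.1; have h3 := (hE c.1 l).2.1
    have h4 := (hE c.2 l).2.2; have h5 := (hE a.1 l).1; have h6 := (hE a.2 l).2.2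
    rw [abs_le] at h1 h2 h3 h4 h5 h6 ⊢
    constructor <;> linarith [h1.1, h1.2, h2.1, h2.2, h3.1, h3.2, h4.1, h4.2, h5.1, h5.2, h6.1, h6.2]
  have hAne : ∀ a ∈ A, a ≠ 0 := by
    intro a ha h0
    obtain ⟨v, hv, rfl⟩ := Finset.mem_image.mp ha
    obtain ⟨hvS, hv0⟩ := Finset.mem_filter.mp hv
    apply hv0
    funext l
    have hl : (v l : ZMod M) = 0 := by simpa [red] using congrFun h0 l
    rw [ZMod.intCast_zmod_eq_zero_iff_dvd] at hl
    have hlt : |v l| < (M : ℤ) := by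
      have := hentry v hvS l
      have hEM' : 6 * (E : ℤ) < (M : ℤ) := by exact_mod_cast hEM
      linarith
    simpa using Int.eq_zero_of_abs_lt_dvd hl hlt
  obtain ⟨lam, hlam⟩ := exists_functional d A hAcard hAne
  -- the functional and its additivity
  let φ : (Fin d → ℤ) → ZMod M := fun v => ∑ l, lam l * (v l : ZMod M)
  have hφ_sub : ∀ v w, φ (v - w) = φ v - φ w := by
    intro v w; simp only [φ, Pi.sub_apply, Int.cast_sub, mul_sub, Finset.sum_sub_distrib]
  have hφ_add : ∀ v w, φ (v + w) = φ v + φ w := by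
    intro v w; simp only [φ, Pi.add_apply, Int.cast_add, mul_add, Finset.sum_add_distrib]
  have hφ_ne : ∀ v ∈ spectrum s t u P Q R, v ≠ 0 → φ v ≠ 0 := by
    intro v hv hv0
    have hmem : red v ∈ A := Finset.mem_image.mpr ⟨v, Finset.mem_filter.mpr ⟨hv, hv0⟩, rfl⟩
    simpa [φ, red] using hlam (red v) hmem
  refine ⟨fun i => φ (s i), fun j => φ (t j), fun k => φ (u k), P, Q, R, ?_, hPart⟩
  intro r a ha b hb c hc heq
  -- the ZMod equation says φ(spectrum vector) = 0
  set v : Fin d → ℤ := (t b.2 - s b.1) + (u c.2 - t c.1) - (u a.2 - s a.1) with hv_def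
  have hvS : v ∈ spectrum s t u P Q R := by
    simp only [spectrum, Finset.mem_biUnion, Finset.mem_univ, true_and, Finset.mem_image, Finset.mem_product]
    exact ⟨r, (a, b, c), ⟨ha, hb, hc⟩, rfl⟩
  have hφv : φ v = 0 := by
    rw [hv_def, hφ_sub, hφ_add, hφ_sub, hφ_sub, hφ_sub, heq, sub_self]
  have hv0 : v = 0 := by
    by_contra h
    exact hφ_ne v hvS h hφv
  -- hence the integer equation holds and the seed's alien-freeness applies
  apply hAF r a ha b hb c hc
  have : (t b.2 - s b.1) + (u c.2 - t c.1) - (u a.2 - s a.1) = 0 := by rw [← hv_def]; exact hv0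
  exact sub_eq_zero.mp this

end Summit.MatrixMultiplication.MatrixMultiplication.Theorems.Thesis.IntegerSeed
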